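import Summits.NavierStokesRegularity.FluidComputer.GateBudgetSwingTransfer
import HarnessLib

/-!
# GateBudget part 109 — the swing transfer from below, I: the entry half band (§291–§292)

Cell `pub-fluidc`, blueprint seat bp1 (gen 39, fourth item); namespace
`Summit.NavierStokesRegularity.FluidComputer.GateBudget`, knob family
`RotorKnob.rotorCircuit K M ε ρ` (modes `0 = a` carrier, `1 = b` clock, `2 = c` trigger,
`3 = d` transfer, `4 = ã` output) from `delayInit`, trigger primitive `C` (`C' = c`). Imports
part 101 (`GateBudgetSwingTransfer`) and through it part 99 (`GateBudgetSwingClock`). HONEST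
FRAMING: a low prior, high value-of-information experiment on Tao's machine paradigm; NOT a
claim that NS blows up. Nothing here is about the Navier–Stokes equations.

THE POINT (SPEC-INPUT-bp1 §CB(3)(d)/§CF: the NECESSITY side of the swing law; first file).
Parts 101–105 price one band swing from ABOVE (`≈ 1.96·A/(θK⁹)`; sufficiency horizon
`0.0656K⁹`, part 108); the necessity count `N ≤ K⁹/7 + 1` (part 72 §219) still rests on part
71's CRUDE floor `1/K⁹` per pulse (`π/2` where the band integral is `≈ 2cos α₁`). This file is
part 101 §279 run FROM BELOW. On the entry half of the band the comparison angle
`w = α₁ + λ(C - C(t₁))`, `λ = ε⁻¹Mκ`, is below the clock angle `α = arccos(b/R₂)` (part 101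
§279(a)) and — by part 99 §274's UPPER angle law for the OUTER ring radius `R₁`, the angles
`arccos(b/R₁)`, `arccos(b/R₂)` differing by at most `δ` on the band — above it up to
`ℓ = 2δ + (π/2)(κ⁻¹ - 1)`: `w ≤ α ≤ w + ℓ`, so `sin α ≤ sin w + ℓ ≤ (1 + ℓ/sin α₁)sin w`, and
with the aspect defect `κc ≤ √(R₂² - b²) = R₂ sin α` the trigger is `≤ R₂ sin w/η`,
`η = κ/(1 + ℓ/sin α₁)`. If the transfer mode is phase-locked FROM BELOW,
`A(sin²(Φ + φ₀) - E) ≤ d²` (part 14 §43's two-sided tracking, to be supplied as in part 102),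
then pointwise `(KAη/(λR₂))·((sin²(w + ψ₁) - E₁)/sin w)·(λc) ≤ Kd²` by a SIGN SPLIT (where
`sin²(w + ψ₁) ≥ E₁` because `ηc ≤ R₂ sin w`, elsewhere because the left side is `≤ 0`) — so
the drift `E₁ = E + π(κ⁻¹ - 1)` stays priced per RADIAN (`≈ 2.07E₁`), not per unit time — and
the left side is `(KAη/(λR₂))·(swingPrim ψ₁ (-E₁) ∘ w)'` (part 99 §275's primitive takes a
drift of either sign). Hence `ã(t) - ã(t₁) ≥ (KAη/(λR₂))·(swingPrim ψ₁ (-E₁) (w(t))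
- swingPrim ψ₁ (-E₁) α₁)` on the entry half, priced by the new half-band value from below
`≥ (cos²ψ₁ - sin²ψ₁)(cos α₁ - cos w) - |sin 2ψ₁|(1 - sin α₁) + E₁ log tan(α₁/2)`; at the dose
midpoint the upper law gives `ε⁻¹M(C(t₂) - C(t₁)) ≥ π - 2α₁ - 2δ`, so `cos w ≤ (1 - κ)π/2 + δ`
there: together (the sequel's first line, with `sin²ψ₁ ≤ cos²ψ₁`) the entry half yields
`≥ (KAη/(λR₂))·((cos²ψ₁ - sin²ψ₁)(cos α₁ - (1 - κ)π/2 - δ) - |sin 2ψ₁|(1 - sin α₁)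
+ E₁ log tan(α₁/2))` — `≈ 0.956·KA/(λR₂)` at `cos α₁ = 31/32`, `|ψ₁| ≤ 0.0075`,
`E₁ ≈ 4·10⁻⁴`, against part 71's `≈ 0.785` (half of `π/2`). FORECAST for the sequel (exit
half, headline discharge, re-count; NOT here): floor `≈ 1.29/K⁹` per band swing (part 72:
`1/K⁹`), necessity ceiling `≈ 0.110K⁹ + 1` (part 72: `K⁹/7 + 1`).

* §291 `sin_sq_shift_ge`, `sin_le_sin_add_of_le`, `swing_step_ge`, `swingPrim_eval_ge`: the
  scalar devices from below (phase lag; `w ≤ α ≤ w + ℓ ⇒ sin α ≤ sin w + ℓ`; the pointwise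
  step with the sign split; the half-band value from below, `E₁ ≥ 0`, `0 < α₁ ≤ w ≤ π/2`).
* §292 `swing_window_upper` (any member, `ε > 0`, `M ≥ 0`; on `[t₁, t₂]`: `b² + c² ≤ R₁²`,
  `c > 0`, `|arccos(b/R₁) - arccos(b/R₂)| ≤ δ`, `b(t₂) = -b(t₁)`): the clock angle from above
  and `π - 2α₁ - 2δ ≤ ε⁻¹M(C(t₂) - C(t₁))`; `swing_transfer_first_ge`, THE ENTRY HALF-BAND LAW
  FROM BELOW (hypotheses of part 101 §279(b) with `c > 0`, the outer ring, `δ ≥ 0`, the phase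
  lock from below); `swing_midpoint_angle`: `cos w ≤ (1 - κ)π/2 + δ` at the midpoint.

HONEST LIMITS. (i) Generic in the member: the phase lock from below, the outer ring `R₁`, the
angle gap `δ` and the aspect defect `κ` are ASSUMED on the band and discharged for the headline
member only in the sequel (forecast `δ ≈ 6·10⁻⁶`, `1 - κ = 10⁻⁴`, `η ≥ 0.998`); (ii) `k = 1`
only (unit lattice); (iii) the exit half, the band floor `≥ (2cos α₁ - …)A/(θK⁹)` and the
re-count of part 72 §219 are NOT here — until then `N ≤ K⁹/7 + 1` STANDS and `≈ 0.110K⁹ + 1`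
is a FORECAST; (iv) nothing about Navier–Stokes.
[cite: Tao2016AveragedNS, §5.5 Theorem 5.3, (5.5), (b-eq), (c-eq), (ta-eq), (energy-con)]
-/

noncomputable section

namespace Summit.NavierStokesRegularity.FluidComputer.GateBudget

open Real Set Filter Topology
open Literature.Analysis.FluidPDE.Tao2016AveragedNS

variable {K M ε ρ : ℝ} {X : ℝ → Fin 5 → ℝ} {C : ℝ → ℝ}

/-! ## §291 Scalar devices from below -/

/-- §291(a) a phase lag costs at most twice its size, from below: `sin x² - 2|l| ≤ sin(x + l)²`
(part 101 §278(a) at `(x + l, -l)`). [derived: part 101 §278] -/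
theorem sin_sq_shift_ge (x l : ℝ) : sin x ^ 2 - 2 * |l| ≤ sin (x + l) ^ 2 := by
  have h := sin_sq_shift_le (x + l) (-l)
  rw [add_neg_cancel_right, abs_neg] at h
  linarith only [h]

/-- §291(b) ABOVE THE WINDOW: `w ≤ α ≤ w + ℓ` forces `sin α ≤ sin w + ℓ`
(`|sin α - sin w| ≤ |α - w|`). [derived: Mathlib] -/
theorem sin_le_sin_add_of_le {w α ℓ : ℝ} (h1 : w ≤ α) (h2 : α ≤ w + ℓ) :
    sin α ≤ sin w + ℓ := by
  have h := Real.abs_sin_sub_sin_le α w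
  rw [abs_of_nonneg (sub_nonneg.2 h1)] at h
  have h3 := le_abs_self (sin α - sin w)
  linarith only [h, h3, h2]

/-- §291(c) THE POINTWISE TRANSFER STEP FROM BELOW (pure algebra; `K, A, η, c, d² ≥ 0`,
`λ, R₂ > 0`, `sin w > 0`): `A(sin²(w + ψ) - E₁) ≤ d²` and `ηc ≤ R₂ sin w` give
`(KAη/(λR₂))·((sin²(w + ψ) - E₁)/sin w)·(λc) ≤ K·d²` — where `sin²(w + ψ) ≥ E₁` because
`ηc/(R₂ sin w) ≤ 1`, elsewhere because the left side is `≤ 0`. [derived: this file] -/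
theorem swing_step_ge {K A lam R₂ w ψ E₁ dsq c η : ℝ} (hK : 0 ≤ K) (hA : 0 ≤ A)
    (hlam : 0 < lam) (hR : 0 < R₂) (hw : 0 < sin w) (hη : 0 ≤ η) (hc0 : 0 ≤ c)
    (hd : A * (sin (w + ψ) ^ 2 - E₁) ≤ dsq) (hd0 : 0 ≤ dsq) (hc : η * c ≤ R₂ * sin w) :
    K * A * η / (lam * R₂) * ((sin (w + ψ) ^ 2 - E₁) / sin w * (lam * c)) ≤ K * dsq := by
  have e : K * A * η / (lam * R₂) * ((sin (w + ψ) ^ 2 - E₁) / sin w * (lam * c))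
      = K * A * (sin (w + ψ) ^ 2 - E₁) * (η * c / (R₂ * sin w)) := by
    field_simp
  rw [e]
  have hq0 : 0 ≤ η * c / (R₂ * sin w) := by positivity
  have hq1 : η * c / (R₂ * sin w) ≤ 1 := by
    rw [div_le_one (by positivity)]
    exact hc
  have hKA : 0 ≤ K * A := mul_nonneg hK hA
  have h2 : K * (A * (sin (w + ψ) ^ 2 - E₁)) ≤ K * dsq := mul_le_mul_of_nonneg_left hd hK
  rcases le_or_gt 0 (sin (w + ψ) ^ 2 - E₁) with hg | hg
  · have h1 : K * A * (sin (w + ψ) ^ 2 - E₁) * (η * c / (R₂ * sin w))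
        ≤ K * A * (sin (w + ψ) ^ 2 - E₁) * 1 :=
      mul_le_mul_of_nonneg_left hq1 (mul_nonneg hKA hg)
    linarith only [h1, h2]
  · have h1 : 0 ≤ K * A * -(sin (w + ψ) ^ 2 - E₁) * (η * c / (R₂ * sin w)) :=
      mul_nonneg (mul_nonneg hKA (by linarith only [hg])) hq0
    have h3 : 0 ≤ K * dsq := mul_nonneg hK hd0
    linarith only [h1, h3]

/-- §291(d) THE HALF-BAND VALUE FROM BELOW of the swing primitive with drift `-E₁`, `E₁ ≥ 0`,
for `0 < α₁ ≤ w ≤ π/2`: `P(w) - P(α₁) ≥ (cos²ψ - sin²ψ)(cos α₁ - cos w)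
- |sin 2ψ|(1 - sin α₁) + E₁·log tan(α₁/2)` (the `cos` terms are exact; `sin` rises;
`(sin²ψ - E₁)·(log tan(w/2) - log tan(α₁/2)) ≥ -E₁·(0 - log tan(α₁/2))`). At `cos α₁ = 31/32`:
`0.969(cos²ψ - sin²ψ) - 0.752|sin 2ψ| - 2.073E₁ - (cos²ψ - sin²ψ)cos w`. [derived: this file] -/
theorem swingPrim_eval_ge (ψ : ℝ) {E₁ α₁ w : ℝ} (hE : 0 ≤ E₁) (hα : 0 < α₁) (hαw : α₁ ≤ w)
    (hw : w ≤ π / 2) :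
    (cos ψ ^ 2 - sin ψ ^ 2) * (cos α₁ - cos w) - |sin (2 * ψ)| * (1 - sin α₁)
        + E₁ * (log (sin (α₁ / 2)) - log (cos (α₁ / 2)))
      ≤ swingPrim ψ (-E₁) w - swingPrim ψ (-E₁) α₁ := by
  have hπ := Real.pi_pos
  have hsin : sin α₁ ≤ sin w :=
    Real.sin_le_sin_of_le_of_le_pi_div_two (by linarith) hw hαw
  have hsin1 : sin w ≤ 1 := Real.sin_le_one w
  -- the half-angle sines and cosines
  have hSα : 0 < sin (α₁ / 2) := Real.sin_pos_of_pos_of_lt_pi (by linarith) (by linarith)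
  have hSw : 0 < sin (w / 2) := Real.sin_pos_of_pos_of_lt_pi (by linarith) (by linarith)
  have hCw : 0 < cos (w / 2) := Real.cos_pos_of_mem_Ioo ⟨by linarith, by linarith⟩
  have hSmono : sin (α₁ / 2) ≤ sin (w / 2) :=
    Real.sin_le_sin_of_le_of_le_pi_div_two (by linarith) (by linarith) (by linarith)
  have hCmono : cos (w / 2) ≤ cos (α₁ / 2) :=
    Real.cos_le_cos_of_nonneg_of_le_pi (by linarith) (by linarith) (by linarith)
  have hSC : sin (w / 2) ≤ cos (w / 2) := by
    rw [← Real.sin_pi_div_two_sub]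
    exact Real.sin_le_sin_of_le_of_le_pi_div_two (by linarith) (by linarith) (by linarith)
  -- `log tan(w/2) ≤ 0` and `log tan` rises
  have hlogw : log (sin (w / 2)) - log (cos (w / 2)) ≤ 0 := by
    linarith only [Real.log_le_log hSw hSC]
  have hlogmono : log (sin (α₁ / 2)) - log (cos (α₁ / 2))
      ≤ log (sin (w / 2)) - log (cos (w / 2)) := by
    linarith only [Real.log_le_log hSα hSmono, Real.log_le_log hCw hCmono]
  -- the cross term `sin 2ψ·(sin w - sin α₁) ≥ -|sin 2ψ|·(1 - sin α₁)`
  have hcross : -(|sin (2 * ψ)| * (1 - sin α₁)) ≤ sin (2 * ψ) * (sin w - sin α₁) := by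
    have h1 : -|sin (2 * ψ)| * (sin w - sin α₁) ≤ sin (2 * ψ) * (sin w - sin α₁) :=
      mul_le_mul_of_nonneg_right (neg_abs_le _) (by linarith only [hsin])
    have h2 : |sin (2 * ψ)| * (sin w - sin α₁) ≤ |sin (2 * ψ)| * (1 - sin α₁) :=
      mul_le_mul_of_nonneg_left (by linarith only [hsin1]) (abs_nonneg _)
    linarith only [h1, h2]
  -- the log term `(sin²ψ - E₁)·(L(w) - L(α₁)) ≥ -E₁·L(w) + E₁·L(α₁) ≥ E₁·L(α₁)`
  have hlog1 : E₁ * (log (sin (α₁ / 2)) - log (cos (α₁ / 2)))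
      ≤ (sin ψ ^ 2 + -E₁) * ((log (sin (w / 2)) - log (cos (w / 2)))
          - (log (sin (α₁ / 2)) - log (cos (α₁ / 2)))) := by
    have h1 : 0 ≤ sin ψ ^ 2 * ((log (sin (w / 2)) - log (cos (w / 2)))
        - (log (sin (α₁ / 2)) - log (cos (α₁ / 2)))) :=
      mul_nonneg (sq_nonneg _) (sub_nonneg.2 hlogmono)
    have h2 : 0 ≤ E₁ * -(log (sin (w / 2)) - log (cos (w / 2))) :=
      mul_nonneg hE (by linarith only [hlogw])
    linarith only [h1, h2]
  unfold swingPrim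
  linarith only [hcross, hlog1]

/-! ## §292 The entry half band from below -/

/-- §292(a) THE CLOCK ANGLE FROM ABOVE (any member, `ε > 0`, `M ≥ 0`; on the band `[t₁, t₂]`:
the OUTER ring `b² + c² ≤ R₁²`, `c > 0`, the two angles `|arccos(b/R₁) - arccos(b/R₂)| ≤ δ`,
and SYMMETRIC EDGES `b(t₂) = -b(t₁)`). For `s ∈ [t₁, t₂]`, with `α = arccos(b/R₂)`,
`α₁ = α(t₁)`: `α(s) ≤ α₁ + 2δ + ε⁻¹M(C(s) - C(t₁))`, `π - α₁ - 2δ - ε⁻¹M(C(t₂) - C(s)) ≤ α(s)`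
and `π - 2α₁ - 2δ ≤ ε⁻¹M(C(t₂) - C(t₁))` (part 99 §274's upper law on `[t₁, s]` and `[s, t₂]`
for the radius `R₁`, moved to the radius `R₂` at the three times, `arccos(-x) = π - arccos x`).
[derived: part 99 §274] -/
theorem swing_window_upper (hX : ∀ t, HasDerivAt X (RotorKnob.rotorCircuit K M ε ρ (X t)) t)
    (hC : ∀ t, HasDerivAt C (X t 2) t) (hε : 0 < ε) (hM : 0 ≤ M) {t₁ t₂ R₁ R₂ δ : ℝ}
    (ht : t₁ ≤ t₂) (hR₁ : 0 < R₁) (hring₁ : ∀ u ∈ Icc t₁ t₂, X u 1 ^ 2 + X u 2 ^ 2 ≤ R₁ ^ 2)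
    (hpos : ∀ u ∈ Icc t₁ t₂, 0 < X u 2)
    (hδ : ∀ u ∈ Icc t₁ t₂, |arccos (X u 1 / R₁) - arccos (X u 1 / R₂)| ≤ δ)
    (hsym : X t₂ 1 = -X t₁ 1) {s : ℝ} (hs : s ∈ Icc t₁ t₂) :
    arccos (X s 1 / R₂) ≤ arccos (X t₁ 1 / R₂) + 2 * δ + ε⁻¹ * M * (C s - C t₁) ∧
      π - arccos (X t₁ 1 / R₂) - 2 * δ - ε⁻¹ * M * (C t₂ - C s) ≤ arccos (X s 1 / R₂) ∧
      π - 2 * arccos (X t₁ 1 / R₂) - 2 * δ ≤ ε⁻¹ * M * (C t₂ - C t₁) := by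
  have h1 := clock_angle_upper hX hC hε hM hs.1 hR₁
    (fun u hu => hring₁ u ⟨hu.1, hu.2.trans hs.2⟩) (fun u hu => hpos u ⟨hu.1, hu.2.trans hs.2⟩)
  have h2 := clock_angle_upper hX hC hε hM hs.2 hR₁
    (fun u hu => hring₁ u ⟨hs.1.trans hu.1, hu.2⟩) (fun u hu => hpos u ⟨hs.1.trans hu.1, hu.2⟩)
  have hneg : arccos (X t₂ 1 / R₂) = π - arccos (X t₁ 1 / R₂) := by
    rw [hsym, neg_div, arccos_neg]
  obtain ⟨-, e1b⟩ := abs_le.1 (hδ t₁ (left_mem_Icc.2 ht))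
  obtain ⟨esa, esb⟩ := abs_le.1 (hδ s hs)
  have e2 := abs_le.1 (hδ t₂ (right_mem_Icc.2 ht))
  rw [hneg] at e2
  refine ⟨by linarith only [h1, e1b, esa], by linarith only [h2, e2.1, esb], ?_⟩
  have e : ε⁻¹ * M * (C t₂ - C t₁) = ε⁻¹ * M * (C s - C t₁) + ε⁻¹ * M * (C t₂ - C s) := by
    ring
  linarith only [h1, h2, e1b, e2.1, e]

/-- §292(b) THE ENTRY HALF-BAND LAW FROM BELOW (any member from `delayInit`, `K ≥ 0`,
`ε, M > 0`, UNIT LATTICE `ε⁻¹Mρ² = 1`; on the band `[t₁, t₂]`: the hypotheses of part 101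
§279(a) `swing_window` with `c > 0`, the outer ring `b² + c² ≤ R₁²`, the angle gap
`|arccos(b/R₁) - arccos(b/R₂)| ≤ δ`, `δ ≥ 0`, `0 < κ ≤ 1`, `A ≥ 0`, and a transfer mode
PHASE-LOCKED FROM BELOW `A(sin²((C - C(r))/ρ² + φ₀) - E) ≤ d²` (any `E`); `λ = ε⁻¹Mκ`,
`α₁ = arccos(b(t₁)/R₂)`, `ψ₁ = (C(t₁) - C(r))/ρ² + φ₀ - α₁`, `E₁ = E + π(κ⁻¹ - 1)`,
`η = κ/(1 + (2δ + (π/2)(κ⁻¹ - 1))/sin α₁)`). For `t ∈ [t₁, t₂]` in the ENTRY HALF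
`2C(t) ≤ C(t₁) + C(t₂)`: `0 < η ≤ 1`, `0 < α₁`, `C(t₁) ≤ C(t)`, `w(t) = α₁ + λ(C(t) - C(t₁)) ≤ π/2`
and `(KAη/(λR₂))·(swingPrim ψ₁ (-E₁) (w(t)) - swingPrim ψ₁ (-E₁) α₁) ≤ ã(t) - ã(t₁)`.
[derived: parts 99 §274–§275, 101 §278–§279; this file §291, §292(a)] -/
theorem swing_transfer_first_ge
    (hX : ∀ t, HasDerivAt X (RotorKnob.rotorCircuit K M ε ρ (X t)) t) (h0 : X 0 = delayInit)
    (hC : ∀ t, HasDerivAt C (X t 2) t) (hK : 0 ≤ K) (hε : 0 < ε) (hM : 0 < M)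
    (hlat : ε⁻¹ * M * ρ ^ 2 = 1) {t₁ t₂ r R₁ R₂ Q κ δ A E φ₀ α₁ ψ₁ E₁ η : ℝ} (ht : t₁ ≤ t₂)
    (hR : 0 < R₂) (hQ : R₂ ^ 2 + ε ^ 2 / M ≤ Q) (hκ0 : 0 < κ) (hκ1 : κ ≤ 1) (hA : 0 ≤ A)
    (hring : ∀ u ∈ Icc t₁ t₂, Q ≤ X u 1 ^ 2 + X u 2 ^ 2)
    (hband : ∀ u ∈ Icc t₁ t₂, X u 1 ^ 2 < R₂ ^ 2)
    (hκ : ∀ u ∈ Icc t₁ t₂, κ * X u 2 ≤ √(R₂ ^ 2 - X u 1 ^ 2))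
    (hpos : ∀ u ∈ Icc t₁ t₂, 0 < X u 2) (hsym : X t₂ 1 = -X t₁ 1) (hR₁ : 0 < R₁)
    (hring₁ : ∀ u ∈ Icc t₁ t₂, X u 1 ^ 2 + X u 2 ^ 2 ≤ R₁ ^ 2) (hδ0 : 0 ≤ δ)
    (hδ : ∀ u ∈ Icc t₁ t₂, |arccos (X u 1 / R₁) - arccos (X u 1 / R₂)| ≤ δ)
    (hd : ∀ u ∈ Icc t₁ t₂, A * (sin ((C u - C r) / ρ ^ 2 + φ₀) ^ 2 - E) ≤ X u 3 ^ 2)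
    (hα₁ : α₁ = arccos (X t₁ 1 / R₂)) (hψ₁ : ψ₁ = (C t₁ - C r) / ρ ^ 2 + φ₀ - α₁)
    (hE₁ : E₁ = E + π * (κ⁻¹ - 1)) (hη : η = κ / (1 + (2 * δ + π / 2 * (κ⁻¹ - 1)) / sin α₁))
    {t : ℝ} (ht₁ : t ∈ Icc t₁ t₂) (hhalf : 2 * C t ≤ C t₁ + C t₂) :
    0 < η ∧ η ≤ 1 ∧ 0 < α₁ ∧ C t₁ ≤ C t ∧ α₁ + ε⁻¹ * M * κ * (C t - C t₁) ≤ π / 2 ∧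
      K * A * η / (ε⁻¹ * M * κ * R₂) *
          (swingPrim ψ₁ (-E₁) (α₁ + ε⁻¹ * M * κ * (C t - C t₁)) - swingPrim ψ₁ (-E₁) α₁)
        ≤ X t 4 - X t₁ 4 := by
  obtain ⟨lam, hlam⟩ : ∃ lam : ℝ, lam = ε⁻¹ * M * κ := ⟨_, rfl⟩
  rw [← hlam]
  have hμ0 : 0 < ε⁻¹ * M := by positivity
  have hlam0 : 0 < lam := by rw [hlam]; positivity
  have hρ2 : (ρ ^ 2)⁻¹ = ε⁻¹ * M := inv_eq_of_mul_eq_one_left hlat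
  have hκinv : 0 ≤ κ⁻¹ - 1 := sub_nonneg.2 ((one_le_inv₀ hκ0).2 hκ1)
  have hkk : κ⁻¹ * κ = 1 := inv_mul_cancel₀ hκ0.ne'
  have hpos' : ∀ u ∈ Icc t₁ t₂, 0 ≤ X u 2 := fun u hu => (hpos u hu).le
  -- `C` is non-decreasing on the band
  have hCm := Thm53.monotoneOn_sub_of_le_deriv (f := C) (f' := fun u => X u 2)
    (Φ := fun _ => (0 : ℝ)) (φ := fun _ => 0) (convex_Icc t₁ t₂) (fun u _ => hC u)
    (fun u _ => hasDerivAt_const u 0) (fun u hu => hpos' u hu)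
  -- the entry angle: `0 < α₁ ≤ π/2`
  obtain ⟨-, hw2, hα0⟩ := swing_window hX h0 hC hε hM ht hR hQ hring hband hκ hsym
    (left_mem_Icc.2 ht)
  rw [← hα₁] at hw2 hα0
  have hα2 : α₁ ≤ π / 2 := by
    have hc12 := hCm (left_mem_Icc.2 ht) (right_mem_Icc.2 ht) ht
    dsimp only at hc12
    have := mul_nonneg hlam0.le (by linarith only [hc12] : (0 : ℝ) ≤ C t₂ - C t₁)
    rw [hlam] at this
    linarith only [hw2, this]
  have hsα : 0 < sin α₁ := sin_pos_of_pos_of_lt_pi hα0 (by linarith only [hα2, pi_pos])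
  -- the slack `ℓ` of the upper window and the factor `η`
  obtain ⟨ℓ, hℓ⟩ : ∃ ℓ : ℝ, ℓ = 2 * δ + π / 2 * (κ⁻¹ - 1) := ⟨_, rfl⟩
  rw [← hℓ] at hη
  have hℓ0 : 0 ≤ ℓ := by rw [hℓ]; positivity
  have hden : 0 < 1 + ℓ / sin α₁ := by positivity
  have hη0 : 0 < η := by rw [hη]; positivity
  have hη1 : η ≤ 1 := by
    rw [hη, div_le_one hden]
    have : 0 ≤ ℓ / sin α₁ := by positivity
    linarith only [hκ1, this]
  -- the pointwise facts on `[t₁, t]`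
  have KEY : ∀ s ∈ Icc t₁ t, 0 < swingAngle α₁ lam C t₁ s ∧ swingAngle α₁ lam C t₁ s ≤ π / 2 ∧
      C t₁ ≤ C s ∧ K * A * η / (lam * R₂) *
        ((sin (swingAngle α₁ lam C t₁ s + ψ₁) ^ 2 - E₁) / sin (swingAngle α₁ lam C t₁ s)
          * (lam * X s 2)) ≤ K * X s 3 ^ 2 := by
    intro s hs
    have hs2 : s ∈ Icc t₁ t₂ := ⟨hs.1, hs.2.trans ht₁.2⟩
    obtain ⟨h1, h2, -⟩ := swing_window hX h0 hC hε hM ht hR hQ hring hband hκ hsym hs2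
    obtain ⟨h3, -, -⟩ := swing_window_upper hX hC hε hM.le ht hR₁ hring₁ hpos hδ hsym hs2
    rw [← hlam, ← hα₁] at h1 h2
    rw [← hα₁] at h3
    have hc1 := hCm (left_mem_Icc.2 ht) hs2 hs.1
    have hc3 := hCm hs2 ht₁ hs.2
    dsimp only at hc1 hc3
    have hc1' : C t₁ ≤ C s := by linarith only [hc1]
    have hfirst : lam * (C s - C t₁) ≤ lam * (C t₂ - C s) :=
      mul_le_mul_of_nonneg_left (by linarith only [hc3, hhalf]) hlam0.le
    unfold swingAngle
    obtain ⟨w, hw⟩ : ∃ w : ℝ, w = α₁ + lam * (C s - C t₁) := ⟨_, rfl⟩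
    rw [← hw] at h1 ⊢
    have hwle : arccos (X s 1 / R₂) ≤ π - w := by rw [hw]; linarith only [h2, hfirst]
    have hw0 : 0 < w := by
      rw [hw]
      have := mul_nonneg hlam0.le (sub_nonneg.2 hc1')
      linarith only [this, hα0]
    have hwπ : w ≤ π / 2 := by linarith only [h1, hwle]
    have hsw : 0 < sin w := sin_pos_of_pos_of_lt_pi hw0 (by linarith only [hwπ, pi_pos])
    have hsinw : sin α₁ ≤ sin w := by
      refine sin_le_sin_of_le_of_le_pi_div_two (by linarith only [hα0, pi_pos]) hwπ ?_
      rw [hw]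
      have := mul_nonneg hlam0.le (sub_nonneg.2 hc1')
      linarith only [this]
    -- the lag of `w` behind the phase, and the clock angle from above: `α ≤ w + ℓ`
    have hl2 : (κ⁻¹ - 1) * (lam * (C s - C t₁)) = (ε⁻¹ * M - lam) * (C s - C t₁) := by
      rw [hlam]
      calc (κ⁻¹ - 1) * (ε⁻¹ * M * κ * (C s - C t₁))
            = (κ⁻¹ * κ) * (ε⁻¹ * M * (C s - C t₁)) - ε⁻¹ * M * κ * (C s - C t₁) := by ring
        _ = (ε⁻¹ * M - ε⁻¹ * M * κ) * (C s - C t₁) := by rw [hkk]; ring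
    have hle : lam * (C s - C t₁) ≤ π / 2 := by linarith only [hwπ, hw, hα0]
    have hlagn : 0 ≤ (ε⁻¹ * M - lam) * (C s - C t₁) := by
      rw [← hl2]
      exact mul_nonneg hκinv (mul_nonneg hlam0.le (sub_nonneg.2 hc1'))
    have hlag : (ε⁻¹ * M - lam) * (C s - C t₁) ≤ π / 2 * (κ⁻¹ - 1) := by
      rw [← hl2]
      have := mul_le_mul_of_nonneg_left hle hκinv
      linarith only [this]
    have hup : arccos (X s 1 / R₂) ≤ w + ℓ := by
      have e : α₁ + 2 * δ + ε⁻¹ * M * (C s - C t₁) = w + 2 * δ + (ε⁻¹ * M - lam) * (C s - C t₁)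
          := by rw [hw]; ring
      rw [e] at h3
      rw [hℓ]
      linarith only [h3, hlag]
    -- the trigger from above: `ηc ≤ R₂ sin w`
    have hκs : κ * X s 2 ≤ R₂ * sin (arccos (X s 1 / R₂)) := by
      rw [Real.sin_arccos, clock_ring_sqrt hR, mul_div_cancel₀ _ hR.ne']
      exact hκ s hs2
    have hsinup : sin (arccos (X s 1 / R₂)) ≤ sin w + ℓ := sin_le_sin_add_of_le h1 hup
    have hηc : η * X s 2 ≤ R₂ * sin w := by
      rw [hη, div_mul_eq_mul_div, div_le_iff₀ hden]
      have h5 : κ * X s 2 ≤ R₂ * (sin w + ℓ) :=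
        hκs.trans (mul_le_mul_of_nonneg_left hsinup hR.le)
      have h8 : ℓ ≤ sin w * (ℓ / sin α₁) := by
        rw [← mul_div_assoc, le_div_iff₀ hsα]
        nlinarith only [hsinw, hℓ0]
      have h6 : R₂ * (sin w + ℓ) ≤ R₂ * sin w * (1 + ℓ / sin α₁) := by
        have := mul_le_mul_of_nonneg_left h8 hR.le
        nlinarith only [this]
      exact h5.trans h6
    -- the phase of the transfer mode is `w + ψ₁` up to the lag
    have hl1 : (C s - C r) / ρ ^ 2 + φ₀ = (w + ψ₁) + (ε⁻¹ * M - lam) * (C s - C t₁) := by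
      rw [hw, hψ₁, div_eq_mul_inv, div_eq_mul_inv, hρ2]
      ring
    have hds : A * (sin (w + ψ₁) ^ 2 - E₁) ≤ X s 3 ^ 2 := by
      have h := hd s hs2
      rw [hl1] at h
      have hsh := mul_le_mul_of_nonneg_left
        (sin_sq_shift_ge (w + ψ₁) ((ε⁻¹ * M - lam) * (C s - C t₁))) hA
      rw [abs_of_nonneg hlagn] at hsh
      have hlb' := mul_le_mul_of_nonneg_left hlag hA
      rw [hE₁]
      nlinarith only [h, hsh, hlb', hA]
    exact ⟨hw0, hwπ, hc1',
      swing_step_ge hK hA hlam0 hR hsw hη0.le (hpos' s hs2) hds (sq_nonneg _) hηc⟩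
  -- the comparison `ã - (KAη/(λR₂))·swingPrim ψ₁ (-E₁) (w)` is non-decreasing on `[t₁, t]`
  have hmono := Thm53.monotoneOn_sub_of_le_deriv (f := fun s => X s 4)
    (f' := fun s => K * X s 3 ^ 2)
    (Φ := fun s => K * A * η / (lam * R₂) * swingPrim ψ₁ (-E₁) (swingAngle α₁ lam C t₁ s))
    (φ := fun s => K * A * η / (lam * R₂) *
      ((sin (swingAngle α₁ lam C t₁ s + ψ₁) ^ 2 - E₁) / sin (swingAngle α₁ lam C t₁ s)
        * (lam * X s 2)))
    (convex_Icc t₁ t) (fun s _ => RotorKnob.hasDerivAt_e hX s)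
    (fun s hs => (((hasDerivAt_swingPrim ψ₁ (-E₁) (KEY s hs).1
      (by linarith only [(KEY s hs).2.1, pi_pos])).comp s
        (hasDerivAt_swingAngle hC α₁ lam t₁ s)).const_mul (K * A * η / (lam * R₂))).congr_deriv
          (by ring))
    (fun s hs => (KEY s hs).2.2.2)
  have h := hmono (left_mem_Icc.2 ht₁.1) (right_mem_Icc.2 ht₁.1) ht₁.1
  have hK1 := KEY t (right_mem_Icc.2 ht₁.1)
  simp only [swingAngle, sub_self, mul_zero, add_zero] at h hK1
  exact ⟨hη0, hη1, hα0, hK1.2.2.1, hK1.2.1, by linarith only [h]⟩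

/-- §292(c) THE COMPARISON ANGLE AT THE DOSE MIDPOINT (hypotheses of §292(a), `0 < κ ≤ 1`,
`0 < α₁ = arccos(b(t₁)/R₂)`): for `t ∈ [t₁, t₂]` with `C(t₁) + C(t₂) ≤ 2C(t)` and
`α₁ + λ(C(t) - C(t₁)) ≤ π/2` (`λ = ε⁻¹Mκ`): `π/2 - ((1 - κ)(π/2 - α₁) + κδ) ≤ α₁ + λ(C(t) - C(t₁))`
and `cos(α₁ + λ(C(t) - C(t₁))) ≤ (1 - κ)π/2 + δ` (`cos w = sin(π/2 - w) ≤ π/2 - w`).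
[derived: this file §292(a)] -/
theorem swing_midpoint_angle (hX : ∀ t, HasDerivAt X (RotorKnob.rotorCircuit K M ε ρ (X t)) t)
    (hC : ∀ t, HasDerivAt C (X t 2) t) (hε : 0 < ε) (hM : 0 ≤ M) {t₁ t₂ R₁ R₂ δ κ α₁ : ℝ}
    (ht : t₁ ≤ t₂) (hR₁ : 0 < R₁) (hring₁ : ∀ u ∈ Icc t₁ t₂, X u 1 ^ 2 + X u 2 ^ 2 ≤ R₁ ^ 2)
    (hpos : ∀ u ∈ Icc t₁ t₂, 0 < X u 2)
    (hδ : ∀ u ∈ Icc t₁ t₂, |arccos (X u 1 / R₁) - arccos (X u 1 / R₂)| ≤ δ)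
    (hsym : X t₂ 1 = -X t₁ 1) (hκ0 : 0 < κ) (hκ1 : κ ≤ 1) (hα₁ : α₁ = arccos (X t₁ 1 / R₂))
    (hα0 : 0 < α₁) {t : ℝ} (ht₁ : t ∈ Icc t₁ t₂) (hhalf : C t₁ + C t₂ ≤ 2 * C t)
    (hwπ : α₁ + ε⁻¹ * M * κ * (C t - C t₁) ≤ π / 2) :
    π / 2 - ((1 - κ) * (π / 2 - α₁) + κ * δ) ≤ α₁ + ε⁻¹ * M * κ * (C t - C t₁) ∧
      cos (α₁ + ε⁻¹ * M * κ * (C t - C t₁)) ≤ (1 - κ) * (π / 2) + δ := by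
  obtain ⟨-, -, h3⟩ := swing_window_upper hX hC hε hM ht hR₁ hring₁ hpos hδ hsym ht₁
  rw [← hα₁] at h3
  have hμ : 0 ≤ ε⁻¹ * M := by positivity
  -- `λ(C t - C t₁) ≥ κ·ε⁻¹M(C t₂ - C t₁)/2 ≥ κ(π/2 - α₁ - δ)`
  have h4 : κ * (ε⁻¹ * M * (C t₂ - C t₁)) ≤ 2 * (ε⁻¹ * M * κ * (C t - C t₁)) := by
    have := mul_le_mul_of_nonneg_left hhalf (mul_nonneg hμ hκ0.le)
    nlinarith only [this]
  have h5 := mul_le_mul_of_nonneg_left h3 hκ0.le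
  have hlow : π / 2 - ((1 - κ) * (π / 2 - α₁) + κ * δ) ≤ α₁ + ε⁻¹ * M * κ * (C t - C t₁) := by
    nlinarith only [h4, h5]
  refine ⟨hlow, ?_⟩
  have hδ0 : 0 ≤ δ := (abs_nonneg _).trans (hδ t₁ (left_mem_Icc.2 ht))
  rw [← Real.sin_pi_div_two_sub]
  have hx0 : 0 ≤ π / 2 - (α₁ + ε⁻¹ * M * κ * (C t - C t₁)) := sub_nonneg.2 hwπ
  have hsx := Real.sin_le hx0
  have h1κ : 0 ≤ 1 - κ := sub_nonneg.2 hκ1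
  have h6 : (1 - κ) * (π / 2 - α₁) ≤ (1 - κ) * (π / 2) :=
    mul_le_mul_of_nonneg_left (by linarith only [hα0]) h1κ
  have h7 : κ * δ ≤ δ := by nlinarith only [hκ1, hδ0]
  linarith only [hsx, hlow, h6, h7]

end Summit.NavierStokesRegularity.FluidComputer.GateBudget
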